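import Mathlib
import Literature.MathematicalPhysics.QuantumLattice.AngularSectors
import Literature.MathematicalPhysics.QuantumLattice.HubbardFermiCurve
import Literature.MathematicalPhysics.QuantumLattice.HubbardBandSectorCountingCounts

/-!
# The single-scale isotropic four-sector counting lemma on the band Fermi curve modulo `2πℤ²`

Stub `stub_fourSectorCount` of the crux `TwSourcedInertness` (line `umklapp-is-a-fold`):
Benfatto–Giuliani–Mastropietro 2006, Lemma 3.1 / App. A2 (A2.0), `|A_h(ω₁;ω₂,ω₃,ω₄)| ≤ Cγ^{-h}|h|`,
generalised to every level `μ` in a compact of the hole-doped band `(-4, 0)` and to momentum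
conservation modulo an arbitrary reciprocal vector `2πG`.

## Proof

Let `w = π/2ⁿ`, `θ_ω = (ω + ½) w` the sector centres and `p = p_μ` the polar parametrisation of the
Fermi curve `{ε = μ}` (toolbox: `Literature/MathematicalPhysics/QuantumLattice/HubbardBandSectorCounting*.lean`).

1. *Cell geometry.* A momentum `k` of the shell `|ε(k) - μ| ≤ w` whose polar angle lies in the sector
   `ω` is within `D w` (coordinatewise) of `p(θ_ω)`; hence an admissible sector triple has
   `|Σⱼ p(θ_{ωⱼ}) - 2πG| ≤ 4Dw`.
2. *Elimination of `ω₄`.* For fixed `(ω₂, ω₃)` at most `C₀` indices `ω₄` fit, and if one does then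
   `|h(θ_{ω₂}, θ_{ω₃})| ≤ 16 D w` with `h(θ₂, θ₃) = ε(p(θ₁) + p(θ₂) + p(θ₃)) - μ` (periodicity of `ε`
   absorbs `G`).
3. *Counting `{|h| ≤ δ}` on the `w`-grid* (`count_pairs_exists`): `≤ K_p (n + 2 + log N)/w = O(2ⁿ(n+1))`.

Small `n` (`w` above a threshold depending only on `μ₁, μ₂`) are absorbed in `K` by the trivial bound `N³`.
-/

set_option linter.dupNamespace false

open Classical

noncomputable section

open Real Set
open Literature.MathematicalPhysics.QuantumLattice
open Literature.MathematicalPhysics.QuantumLattice.BandSectorCounting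

namespace Summit.HubbardSuperconductivity.HubbardSuperconductivity.Theorems

set_option maxHeartbeats 800000 in
/-- **The single-scale isotropic four-sector counting lemma on the band Fermi curve modulo `2πℤ²`**
(Benfatto–Giuliani–Mastropietro 2006, Lemma 3.1 / App. A2 eq. (A2.0),
`|A_h(ω₁;ω₂,ω₃,ω₄)| ≤ Cγ^{-h}|h|`, generalised from small filling and `G = 0` to every level `μ`
in a compact of the hole-doped band `(-4, 0)` and to momentum conservation modulo an arbitrary
reciprocal vector `2πG`): with the sector of one leg fixed, the number of sector triples
`(ω₂, ω₃, ω₄)` of angular width `π/2ⁿ` for which momenta of the shell `|ε - μ| ≤ π/2ⁿ` in the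
prescribed sectors can satisfy `k₁ + k₂ + k₃ + k₄ = 2πG` exactly is at most `K·2ⁿ·(n+1)`,
uniformly in `G` and in `μ ∈ [μ₁, μ₂]`. Source of the original (small filling, `G = 0`): G. Benfatto,
A. Giuliani, V. Mastropietro, Ann. Henri Poincaré 7 (2006), Lemma 3.1 and App. A2 (A2.0); the proof here is the
one-dimensional fibration scheme of `Literature/MathematicalPhysics/QuantumLattice/HubbardBandSectorCounting*`. -/
theorem stub_fourSectorCount :
    ∀ μ₁ μ₂ : ℝ, -4 < μ₁ → μ₁ ≤ μ₂ → μ₂ < 0 → ∃ K : ℝ, 0 < K ∧ ∀ μ ∈ Set.Icc μ₁ μ₂, ∀ (n : ℕ) (G : Fin 2 → ℤ) (ω₁ : Fin (Literature.MathematicalPhysics.QuantumLattice.sectorCount n)), (((Finset.univ : Finset (Fin (Literature.MathematicalPhysics.QuantumLattice.sectorCount n) × Fin (Literature.MathematicalPhysics.QuantumLattice.sectorCount n) × Fin (Literature.MathematicalPhysics.QuantumLattice.sectorCount n))).filter (fun ω => ∃ k : Fin 4 → Fin 2 → ℝ, (∀ j i, |k j i| < Real.pi) ∧ (∀ j, |Literature.MathematicalPhysics.QuantumLattice.sqDispersion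 (k j) - μ| ≤ Literature.MathematicalPhysics.QuantumLattice.sectorWidth n) ∧ Literature.MathematicalPhysics.QuantumLattice.sectorIndex n (Complex.arg (⟨k 0 0, k 0 1⟩ : ℂ)) = (ω₁ : ℕ) ∧ Literature.MathematicalPhysics.QuantumLattice.sectorIndex n (Complex.arg (⟨k 1 0, k 1 1⟩ : ℂ)) = (ω.1 : ℕ) ∧ Literature.MathematicalPhysics.QuantumLattice.sectorIndex n (Complex.arg (⟨k 2 0, k 2 1⟩ : ℂ)) = (ω.2.1 : ℕ) ∧ Literature.MathematicalPhysics.QuantumLattice.sectorIndex n (Complex.arg (⟨k 3 0, k 3 1⟩ : ℂ)) = (ω.2.2 : ℕ) ∧ (∀ i, ∑ j, k j i = 2 * Real.pi * (G i : ℝ)))).card : ℝ) ≤ K * 2 ^ n * ((n : ℝ) + 1) := by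
  intro μ₁ μ₂ hμ₁ h12 hμ₂
  -- the level range `[a', b']` and its uniform bounds
  have ha : -4 < (μ₁ - 4) / 2 := by linarith
  have hab : (μ₁ - 4) / 2 ≤ μ₂ / 2 := by linarith
  have hb : μ₂ / 2 < 0 := by linarith
  obtain ⟨B, -⟩ : ∃ B : BandBounds ((μ₁ - 4) / 2) (μ₂ / 2), B = bandBounds ha hab hb := ⟨_, rfl⟩
  have hm₀ : 0 < min (μ₁ - (μ₁ - 4) / 2) (μ₂ / 2 - μ₂) := lt_min (by linarith) (by linarith)
  obtain ⟨τ, lam, ηo, η₀, η₁, hτ, hτπ, hlam, hηo, hη₀, hη₀m, hη₁, hcov, hodd, heven, hH⟩ :=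
    exists_small_constants B hm₀
  have hD := B.Dcell_pos
  have hCδ : 0 < 16 * B.Dcell := by positivity
  obtain ⟨Kp, hKp, hcount⟩ := count_pairs_exists B hCδ hτ hτπ hlam hηo hη₀ hη₁ hcov hodd heven hH
  have hum := B.umin_pos
  have hπ := Real.pi_pos
  -- the threshold on `w` and the two constants
  obtain ⟨w₀, hw₀⟩ : ∃ w₀ : ℝ, w₀ = min 1 (min (min (μ₁ - (μ₁ - 4) / 2) (μ₂ / 2 - μ₂)) (η₀ / (4 * (16 * B.Dcell)))) := ⟨_, rfl⟩
  have hw₀pos : 0 < w₀ := by rw [hw₀]; exact lt_min (by norm_num) (lt_min hm₀ (by positivity))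
  obtain ⟨C₀, hC₀⟩ : ∃ C₀ : ℝ, C₀ = 3 * (2 * (π * (Real.sqrt 2 * (4 * B.Dcell) / B.umin)) + 1) := ⟨_, rfl⟩
  have hC₀pos : 0 < C₀ := by rw [hC₀]; positivity
  obtain ⟨K₁, hK₁⟩ : ∃ K₁ : ℝ, K₁ = 8 * (π / w₀) ^ 2 := ⟨_, rfl⟩
  obtain ⟨K₂, hK₂⟩ : ∃ K₂ : ℝ, K₂ = C₀ * Kp * 3 / π := ⟨_, rfl⟩
  have hK₁pos : 0 < K₁ := by rw [hK₁]; positivity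
  have hK₂pos : 0 < K₂ := by rw [hK₂]; positivity
  refine ⟨K₁ + K₂, by positivity, ?_⟩
  intro μ hμ n G ω₁
  have hwpos : 0 < sectorWidth n := sectorWidth_pos n
  have hNw : (sectorCount n : ℝ) * sectorWidth n = 2 * π := sectorCount_mul_sectorWidth n
  have h2n : (2 : ℝ) ^ n * sectorWidth n = π := by rw [sectorWidth]; field_simp
  have hNeq : sectorCount n = 2 * 2 ^ n := by unfold sectorCount; ring
  have hNreal : (sectorCount n : ℝ) = 2 * 2 ^ n := by rw [hNeq]; push_cast; ring
  have hsc : ∀ i : ℕ, sectorCenter n i = sectorWidth n / 2 + i * sectorWidth n := sectorCenter_eq n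
  generalize hwdef : sectorWidth n = w at hwpos hNw h2n hsc ⊢
  have hμab : μ ∈ Icc ((μ₁ - 4) / 2) (μ₂ / 2) := ⟨by linarith only [hμ.1, hμ₁], by linarith only [hμ.2, hμ₂]⟩
  have h2npos : (0 : ℝ) < 2 ^ n := by positivity
  -- the trivial bound `N³`
  have htriv : ∀ (pr : Fin (sectorCount n) × Fin (sectorCount n) × Fin (sectorCount n) → Prop) [DecidablePred pr],
      ((((Finset.univ : Finset (Fin (sectorCount n) × Fin (sectorCount n) × Fin (sectorCount n))).filter pr).card : ℝ)) ≤ (sectorCount n : ℝ) ^ 3 := by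
    intro pr _
    have h1 := Finset.card_filter_le (Finset.univ : Finset (Fin (sectorCount n) × Fin (sectorCount n) × Fin (sectorCount n))) pr
    rw [Finset.card_univ, Fintype.card_prod, Fintype.card_prod, Fintype.card_fin] at h1
    have : ((((Finset.univ : Finset (Fin (sectorCount n) × Fin (sectorCount n) × Fin (sectorCount n))).filter pr).card : ℝ)) ≤
        ((sectorCount n * (sectorCount n * sectorCount n) : ℕ) : ℝ) := by exact_mod_cast h1
    calc _ ≤ ((sectorCount n * (sectorCount n * sectorCount n) : ℕ) : ℝ) := this
      _ = (sectorCount n : ℝ) ^ 3 := by push_cast; ring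
  by_cases hwle : w ≤ w₀
  · -- the main case
    have hw1 : w ≤ 1 := hwle.trans (by rw [hw₀]; exact min_le_left _ _)
    have hwm : w ≤ min (μ₁ - (μ₁ - 4) / 2) (μ₂ / 2 - μ₂) :=
      hwle.trans (by rw [hw₀]; exact (min_le_right _ _).trans (min_le_left _ _))
    have hwη : w ≤ η₀ / (4 * (16 * B.Dcell)) := hwle.trans (by rw [hw₀]; exact (min_le_right _ _).trans (min_le_right _ _))
    have h2δ : 16 * B.Dcell * w ≤ η₀ / 2 := by
      have := mul_le_mul_of_nonneg_left hwη hCδ.le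
      have e : 16 * B.Dcell * (η₀ / (4 * (16 * B.Dcell))) = η₀ / 4 := by field_simp
      rw [e] at this; linarith only [this, hη₀]
    have hm1 : min (μ₁ - (μ₁ - 4) / 2) (μ₂ / 2 - μ₂) ≤ μ₁ - (μ₁ - 4) / 2 := min_le_left _ _
    have hm2 : min (μ₁ - (μ₁ - 4) / 2) (μ₂ / 2 - μ₂) ≤ μ₂ / 2 - μ₂ := min_le_right _ _
    have hlo : (μ₁ - 4) / 2 ≤ μ - η₀ := by linarith only [hμ.1, hη₀m, hm1]
    have hhi : μ + η₀ ≤ μ₂ / 2 := by linarith only [hμ.2, hη₀m, hm2]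
    have hlom : (μ₁ - 4) / 2 ≤ μ - min (μ₁ - (μ₁ - 4) / 2) (μ₂ / 2 - μ₂) := by linarith only [hμ.1, hm1]
    have hhim : μ + min (μ₁ - (μ₁ - 4) / 2) (μ₂ / 2 - μ₂) ≤ μ₂ / 2 := by linarith only [hμ.2, hm2]
    -- Step 1: the admissible triples have their centre sums close to `2πG`
    have hsub : (Finset.univ : Finset (Fin (sectorCount n) × Fin (sectorCount n) × Fin (sectorCount n))).filter (fun ω => ∃ k : Fin 4 → Fin 2 → ℝ,
        (∀ j i, |k j i| < Real.pi) ∧ (∀ j, |sqDispersion (k j) - μ| ≤ w) ∧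
        sectorIndex n (Complex.arg (⟨k 0 0, k 0 1⟩ : ℂ)) = (ω₁ : ℕ) ∧
        sectorIndex n (Complex.arg (⟨k 1 0, k 1 1⟩ : ℂ)) = (ω.1 : ℕ) ∧
        sectorIndex n (Complex.arg (⟨k 2 0, k 2 1⟩ : ℂ)) = (ω.2.1 : ℕ) ∧
        sectorIndex n (Complex.arg (⟨k 3 0, k 3 1⟩ : ℂ)) = (ω.2.2 : ℕ) ∧ (∀ i, ∑ j, k j i = 2 * Real.pi * (G i : ℝ))) ⊆
      (Finset.univ : Finset (Fin (sectorCount n) × Fin (sectorCount n) × Fin (sectorCount n))).filter (fun ω =>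
        |bandX μ (w / 2 + ((ω₁ : ℕ) : ℝ) * w) + bandX μ (w / 2 + ((ω.1 : ℕ) : ℝ) * w) + bandX μ (w / 2 + ((ω.2.1 : ℕ) : ℝ) * w) +
            bandX μ (w / 2 + ((ω.2.2 : ℕ) : ℝ) * w) - 2 * π * (G 0 : ℝ)| ≤ 4 * B.Dcell * w ∧
        |bandY μ (w / 2 + ((ω₁ : ℕ) : ℝ) * w) + bandY μ (w / 2 + ((ω.1 : ℕ) : ℝ) * w) + bandY μ (w / 2 + ((ω.2.1 : ℕ) : ℝ) * w) +
            bandY μ (w / 2 + ((ω.2.2 : ℕ) : ℝ) * w) - 2 * π * (G 1 : ℝ)| ≤ 4 * B.Dcell * w) := by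
      intro ω hω
      rw [Finset.mem_filter] at hω
      obtain ⟨-, k, hk, hsh, hi0, hi1, hi2, hi3, hsum⟩ := hω
      have hsh' : ∀ j, |sqDispersion (k j) - μ| ≤ sectorWidth n := by rw [hwdef]; exact hsh
      have hwm' : sectorWidth n ≤ min (μ₁ - (μ₁ - 4) / 2) (μ₂ / 2 - μ₂) := by rw [hwdef]; exact hwm
      have c0 := cell B hμab (hk 0) (hsh' 0) hwm' hlom hhim hi0
      have c1 := cell B hμab (hk 1) (hsh' 1) hwm' hlom hhim hi1
      have c2 := cell B hμab (hk 2) (hsh' 2) hwm' hlom hhim hi2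
      have c3 := cell B hμab (hk 3) (hsh' 3) hwm' hlom hhim hi3
      rw [hsc, hwdef] at c0 c1 c2 c3
      rw [Finset.mem_filter]
      refine ⟨Finset.mem_univ _, ?_, ?_⟩
      · have hs := hsum 0
        rw [Fin.sum_univ_four] at hs
        have e : bandX μ (w / 2 + ((ω₁ : ℕ) : ℝ) * w) + bandX μ (w / 2 + ((ω.1 : ℕ) : ℝ) * w) + bandX μ (w / 2 + ((ω.2.1 : ℕ) : ℝ) * w) +
            bandX μ (w / 2 + ((ω.2.2 : ℕ) : ℝ) * w) - 2 * π * (G 0 : ℝ) =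
            -(k 0 0 - bandX μ (w / 2 + ((ω₁ : ℕ) : ℝ) * w)) + -(k 1 0 - bandX μ (w / 2 + ((ω.1 : ℕ) : ℝ) * w)) +
            -(k 2 0 - bandX μ (w / 2 + ((ω.2.1 : ℕ) : ℝ) * w)) + -(k 3 0 - bandX μ (w / 2 + ((ω.2.2 : ℕ) : ℝ) * w)) := by
          rw [← hs]; ring
        rw [e]
        calc _ ≤ |-(k 0 0 - bandX μ (w / 2 + ((ω₁ : ℕ) : ℝ) * w))| + |-(k 1 0 - bandX μ (w / 2 + ((ω.1 : ℕ) : ℝ) * w))| +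
              |-(k 2 0 - bandX μ (w / 2 + ((ω.2.1 : ℕ) : ℝ) * w))| + |-(k 3 0 - bandX μ (w / 2 + ((ω.2.2 : ℕ) : ℝ) * w))| := by
              refine (abs_add_le _ _).trans (add_le_add ((abs_add_le _ _).trans (add_le_add (abs_add_le _ _) le_rfl)) le_rfl)
          _ ≤ 4 * B.Dcell * w := by rw [abs_neg, abs_neg, abs_neg, abs_neg]; linarith [c0.1, c1.1, c2.1, c3.1]
      · have hs := hsum 1
        rw [Fin.sum_univ_four] at hs
        have e : bandY μ (w / 2 + ((ω₁ : ℕ) : ℝ) * w) + bandY μ (w / 2 + ((ω.1 : ℕ) : ℝ) * w) + bandY μ (w / 2 + ((ω.2.1 : ℕ) : ℝ) * w) +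
            bandY μ (w / 2 + ((ω.2.2 : ℕ) : ℝ) * w) - 2 * π * (G 1 : ℝ) =
            -(k 0 1 - bandY μ (w / 2 + ((ω₁ : ℕ) : ℝ) * w)) + -(k 1 1 - bandY μ (w / 2 + ((ω.1 : ℕ) : ℝ) * w)) +
            -(k 2 1 - bandY μ (w / 2 + ((ω.2.1 : ℕ) : ℝ) * w)) + -(k 3 1 - bandY μ (w / 2 + ((ω.2.2 : ℕ) : ℝ) * w)) := by
          rw [← hs]; ring
        rw [e]
        calc _ ≤ |-(k 0 1 - bandY μ (w / 2 + ((ω₁ : ℕ) : ℝ) * w))| + |-(k 1 1 - bandY μ (w / 2 + ((ω.1 : ℕ) : ℝ) * w))| +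
              |-(k 2 1 - bandY μ (w / 2 + ((ω.2.1 : ℕ) : ℝ) * w))| + |-(k 3 1 - bandY μ (w / 2 + ((ω.2.2 : ℕ) : ℝ) * w))| := by
              refine (abs_add_le _ _).trans (add_le_add ((abs_add_le _ _).trans (add_le_add (abs_add_le _ _) le_rfl)) le_rfl)
          _ ≤ 4 * B.Dcell * w := by rw [abs_neg, abs_neg, abs_neg, abs_neg]; linarith [c0.2, c1.2, c2.2, c3.2]
    -- Step 2: eliminate the last index
    have hr : 0 ≤ 4 * B.Dcell * w := by positivity
    have hT'le : ((((Finset.univ : Finset (Fin (sectorCount n) × Fin (sectorCount n) × Fin (sectorCount n))).filter (fun ω =>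
        |bandX μ (w / 2 + ((ω₁ : ℕ) : ℝ) * w) + bandX μ (w / 2 + ((ω.1 : ℕ) : ℝ) * w) + bandX μ (w / 2 + ((ω.2.1 : ℕ) : ℝ) * w) +
            bandX μ (w / 2 + ((ω.2.2 : ℕ) : ℝ) * w) - 2 * π * (G 0 : ℝ)| ≤ 4 * B.Dcell * w ∧
        |bandY μ (w / 2 + ((ω₁ : ℕ) : ℝ) * w) + bandY μ (w / 2 + ((ω.1 : ℕ) : ℝ) * w) + bandY μ (w / 2 + ((ω.2.1 : ℕ) : ℝ) * w) +
            bandY μ (w / 2 + ((ω.2.2 : ℕ) : ℝ) * w) - 2 * π * (G 1 : ℝ)| ≤ 4 * B.Dcell * w)).card : ℝ)) ≤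
        C₀ * ((((Finset.range (sectorCount n) ×ˢ Finset.range (sectorCount n)).filter fun p : ℕ × ℕ =>
          |hfun μ (w / 2 + ((ω₁ : ℕ) : ℝ) * w) (w / 2 + p.1 * w) (w / 2 + p.2 * w)| ≤ 16 * B.Dcell * w).card : ℝ)) := by
      refine card_prod3_le (N := sectorCount n)
        (Q := fun i c d => |bandX μ (w / 2 + ((ω₁ : ℕ) : ℝ) * w) + bandX μ (w / 2 + i * w) + bandX μ (w / 2 + c * w) + bandX μ (w / 2 + d * w) - 2 * π * (G 0 : ℝ)| ≤ 4 * B.Dcell * w ∧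
          |bandY μ (w / 2 + ((ω₁ : ℕ) : ℝ) * w) + bandY μ (w / 2 + i * w) + bandY μ (w / 2 + c * w) + bandY μ (w / 2 + d * w) - 2 * π * (G 1 : ℝ)| ≤ 4 * B.Dcell * w)
        (R := fun i c => |hfun μ (w / 2 + ((ω₁ : ℕ) : ℝ) * w) (w / 2 + i * w) (w / 2 + c * w)| ≤ 16 * B.Dcell * w) hC₀pos.le ?_ ?_
      · intro i c hi hc
        have hbox := card_grid_in_box_le B hμab hwpos hNw hr (N := sectorCount n)
          (x := 2 * π * (G 0 : ℝ) - bandX μ (w / 2 + ((ω₁ : ℕ) : ℝ) * w) - bandX μ (w / 2 + i * w) - bandX μ (w / 2 + c * w))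
          (y := 2 * π * (G 1 : ℝ) - bandY μ (w / 2 + ((ω₁ : ℕ) : ℝ) * w) - bandY μ (w / 2 + i * w) - bandY μ (w / 2 + c * w))
        have heq : ((Finset.range (sectorCount n)).filter fun d : ℕ =>
            |bandX μ (w / 2 + ((ω₁ : ℕ) : ℝ) * w) + bandX μ (w / 2 + i * w) + bandX μ (w / 2 + c * w) + bandX μ (w / 2 + d * w) - 2 * π * (G 0 : ℝ)| ≤ 4 * B.Dcell * w ∧
            |bandY μ (w / 2 + ((ω₁ : ℕ) : ℝ) * w) + bandY μ (w / 2 + i * w) + bandY μ (w / 2 + c * w) + bandY μ (w / 2 + d * w) - 2 * π * (G 1 : ℝ)| ≤ 4 * B.Dcell * w) =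
            ((Finset.range (sectorCount n)).filter fun d : ℕ =>
            |bandX μ (w / 2 + d * w) - (2 * π * (G 0 : ℝ) - bandX μ (w / 2 + ((ω₁ : ℕ) : ℝ) * w) - bandX μ (w / 2 + i * w) - bandX μ (w / 2 + c * w))| ≤ 4 * B.Dcell * w ∧
            |bandY μ (w / 2 + d * w) - (2 * π * (G 1 : ℝ) - bandY μ (w / 2 + ((ω₁ : ℕ) : ℝ) * w) - bandY μ (w / 2 + i * w) - bandY μ (w / 2 + c * w))| ≤ 4 * B.Dcell * w) := by
          refine Finset.filter_congr fun d _ => ?_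
          rw [show bandX μ (w / 2 + ((ω₁ : ℕ) : ℝ) * w) + bandX μ (w / 2 + i * w) + bandX μ (w / 2 + c * w) + bandX μ (w / 2 + d * w) - 2 * π * (G 0 : ℝ) =
            bandX μ (w / 2 + d * w) - (2 * π * (G 0 : ℝ) - bandX μ (w / 2 + ((ω₁ : ℕ) : ℝ) * w) - bandX μ (w / 2 + i * w) - bandX μ (w / 2 + c * w)) by ring,
            show bandY μ (w / 2 + ((ω₁ : ℕ) : ℝ) * w) + bandY μ (w / 2 + i * w) + bandY μ (w / 2 + c * w) + bandY μ (w / 2 + d * w) - 2 * π * (G 1 : ℝ) =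
            bandY μ (w / 2 + d * w) - (2 * π * (G 1 : ℝ) - bandY μ (w / 2 + ((ω₁ : ℕ) : ℝ) * w) - bandY μ (w / 2 + i * w) - bandY μ (w / 2 + c * w)) by ring]
        rw [heq]
        refine hbox.trans (le_of_eq ?_)
        rw [hC₀]; field_simp
      · intro i c d hi hc hd hQ
        have := abs_hfun_le_of_sum B hμab hQ.1 hQ.2
        linarith
    -- Step 3: the two-dimensional count
    have hP := hcount μ hμab hlo hhi (w / 2 + ((ω₁ : ℕ) : ℝ) * w) w (sectorCount n) (2 ^ n) n hwpos hw1 hNw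
      (by push_cast; exact h2n) hNeq h2n h2δ
    clear hcount
    -- Step 4: arithmetic
    have hlogN : Real.log (sectorCount n : ℕ) ≤ (n : ℝ) + 1 := by rw [hNreal]; exact log_two_mul_two_pow_le n
    have hwinv : 1 / w = 2 ^ n / π := by rw [← h2n]; field_simp
    have e1 := Finset.card_le_card hsub
    have e1' : ((((Finset.univ : Finset (Fin (sectorCount n) × Fin (sectorCount n) × Fin (sectorCount n))).filter (fun ω => ∃ k : Fin 4 → Fin 2 → ℝ,
        (∀ j i, |k j i| < Real.pi) ∧ (∀ j, |sqDispersion (k j) - μ| ≤ w) ∧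
        sectorIndex n (Complex.arg (⟨k 0 0, k 0 1⟩ : ℂ)) = (ω₁ : ℕ) ∧
        sectorIndex n (Complex.arg (⟨k 1 0, k 1 1⟩ : ℂ)) = (ω.1 : ℕ) ∧
        sectorIndex n (Complex.arg (⟨k 2 0, k 2 1⟩ : ℂ)) = (ω.2.1 : ℕ) ∧
        sectorIndex n (Complex.arg (⟨k 3 0, k 3 1⟩ : ℂ)) = (ω.2.2 : ℕ) ∧ (∀ i, ∑ j, k j i = 2 * Real.pi * (G i : ℝ)))).card : ℝ)) ≤
        K₂ * 2 ^ n * ((n : ℝ) + 1) := by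
      have e2 : Kp * ((n : ℝ) + 2 + Real.log (sectorCount n : ℕ)) / w ≤ Kp * (3 * ((n : ℝ) + 1)) / w := by
        apply div_le_div_of_nonneg_right _ hwpos.le
        apply mul_le_mul_of_nonneg_left _ hKp.le
        linarith only [hlogN]
      have e3 : Kp * (3 * ((n : ℝ) + 1)) / w = Kp * 3 / π * 2 ^ n * ((n : ℝ) + 1) := by
        rw [div_eq_mul_one_div _ w, hwinv]; ring
      have e4 : C₀ * (Kp * 3 / π * 2 ^ n * ((n : ℝ) + 1)) = K₂ * 2 ^ n * ((n : ℝ) + 1) := by rw [hK₂]; ring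
      calc _ ≤ _ := by exact_mod_cast e1
        _ ≤ C₀ * (Kp * ((n : ℝ) + 2 + Real.log (sectorCount n : ℕ)) / w) := hT'le.trans (mul_le_mul_of_nonneg_left hP hC₀pos.le)
        _ ≤ C₀ * (Kp * (3 * ((n : ℝ) + 1)) / w) := mul_le_mul_of_nonneg_left e2 hC₀pos.le
        _ = K₂ * 2 ^ n * ((n : ℝ) + 1) := by rw [e3, e4]
    refine e1'.trans ?_
    have : 0 ≤ K₁ * 2 ^ n * ((n : ℝ) + 1) := by positivity
    linarith only [this]
  · -- small `n`: `2ⁿ < π / w₀`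
    clear hcount
    push Not at hwle
    have h2nlt : (2 : ℝ) ^ n ≤ π / w₀ := by
      rw [le_div_iff₀ hw₀pos, ← h2n]
      exact mul_le_mul_of_nonneg_left hwle.le h2npos.le
    have hbound : (sectorCount n : ℝ) ^ 3 ≤ K₁ * 2 ^ n := by
      rw [hNreal, hK₁]
      have hsq : ((2 : ℝ) ^ n) ^ 2 ≤ (π / w₀) ^ 2 := pow_le_pow_left₀ h2npos.le h2nlt 2
      have e : (2 * (2 : ℝ) ^ n) ^ 3 = 8 * ((2 : ℝ) ^ n) ^ 2 * 2 ^ n := by ring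
      rw [e]
      exact mul_le_mul_of_nonneg_right (mul_le_mul_of_nonneg_left hsq (by norm_num)) h2npos.le
    refine (htriv _).trans (hbound.trans ?_)
    have h1 : K₁ * 2 ^ n ≤ (K₁ + K₂) * 2 ^ n := mul_le_mul_of_nonneg_right (by linarith only [hK₂pos]) h2npos.le
    have h2 : (K₁ + K₂) * 2 ^ n ≤ (K₁ + K₂) * 2 ^ n * ((n : ℝ) + 1) :=
      le_mul_of_one_le_right (by positivity) (by linarith only [(by positivity : (0:ℝ) ≤ n)])
    linarith only [h1, h2]

end Summit.HubbardSuperconductivity.HubbardSuperconductivity.Theorems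

end
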